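import Summits.MatrixMultiplication.MatrixMultiplication.Theorems.SaturationLadderCornerBand
import Summits.MatrixMultiplication.MatrixMultiplication.Theorems.SaturationLadderTwinFamilyY64
import HarnessLib

/-!
# SaturationLadder — Kernel XXVIII (iii): the CORNER FAMILY — exact twin points with defects `→ c₂`

Support for the deciding crux `SubexpSaturation` (h₁, item 25909) of `Theses/SaturationLadder.lean`
(cell `decomp-mm`, lens «grading / quantitative ladder», gen 56).  No definitions, no named facts,
no `sorry`.  Third file of `…CornerBandCore → …CornerBand → …CornerFamily`.

THE CORNER FAMILY.  Along the sharp band the pencil parameter may MOVE with the scale: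
`q_j = 10j`, `p_j = ⌈25 j·log(5/4)/log 2⌉ + 29 = ⌈10 κ₀ j⌉ + 29` (`κ₀ = (5/2) log₂(5/4) = 0.80482…`,
the zero of `δ`), i.e. `κ_j = p_j/q_j = κ₀ + (2.9…3.0)/j ↓ κ₀`; letter counts
`(n₁, …, n₆) = (30j² + 20j, 20j²·2^{j+1} − n₃, 30j² + 20j + 2p_j, 10j² − 20j, 0, 20j²)`, frequencies
`(n₁/n₆, n₃/n₆) → (3/2, 3/2)` — the CORNER of the twin hexagon where both margins of the exact six-type
theorem vanish.  Results (for every `p` in the window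
`25 j log(5/4) + 29 log 2 ≤ p log 2 ≤ 25 j log(5/4) + 30 log 2`, which `p_j` satisfies — `corner_p_spec`):

* `corner_p_le`     — `p ≤ q_j` from `j = 16` on (at `j = 16`: `p_16 = 158 ≤ 160`);
* `corner_band`     — the band condition `c₁(κ_j)·j + 2 ≤ j²·δ(κ_j)` for every `j ≥ 16`
                      (`j² δ(κ_j) = j p log 2/10 − (5/2) j² log(5/4) ≥ 2.9 j log 2 ≥ 2 log(5/2)·j + 2`);
* `corner_tight`, `cornerFamily_tight` — **`ω(1, t_j, r_j) = 1 + r_j` for EVERY `j ≥ 16`** (`≤`);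
* `corner_defect_le` — **`(1 − t_j) log r_j ≤ c₂ + 2 log 2 / j`**, `c₂ = (5 log(5/4) + 3 log 2)/3 =
  (5 log 5 − 7 log 2)/3 = 1.06505…` the twin-class ceiling of `GaugeConeClasses.lean`;
* `corner_logTheta_tendsto` — the family constants `log θ_j = (1 + p_j/(15j)) log 2` are squeezed in
  `[c₂ + (29/15) log 2/j, c₂ + 2 log 2/j]`, hence **`log θ_j → c₂`**: the corner family realises the
  class ceiling in the limit, with every member an exact value and explicit onset `j = 16`
  (`t_16 = 0.933`, `r_16 ≈ 8.6·10⁴`).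

What this does NOT give: a uniform clause `U(c)` for `c < 47 log 2/30`; the tail clauses at the flat
rates `log θ(κ)` of fixed members (`(5,6) ↦ 1.0783` from `t = 0.9834`, …) are the next file.
Numerics: `gen56/num/band_verify.py`, `corner_opt.py` (the real-optimal twin shapes have
`D*_j ≤ 1.06631`, so the corner family is within `0.3/j` of optimal).

References: D. Coppersmith, S. Winograd, J. Symbolic Comput. 9 (1990) §8 (key
`CoppersmithWinograd1990`); J. Alman, R. Duan, V. Vassilevska Williams, Y. Xu, Z. Xu, R. Zhou, SODA
2025, §3.4 (key `AlmanDuanVassilevskaWilliamsXuXuZhou2025`).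
-/

set_option linter.dupNamespace false
-- (single-conjunct summit: the namespace repeats `MatrixMultiplication`)

noncomputable section

namespace Summit.MatrixMultiplication.MatrixMultiplication.Theorems.SaturationLadderCornerFamily

open Filter Topology
open Literature.Computability.AlgebraicComplexity
open Summit.MatrixMultiplication.MatrixMultiplication.Theorems.SaturationLadderCornerBand
  (band_tight band_defect_le)
open Summit.MatrixMultiplication.MatrixMultiplication.Theorems.SaturationLadderTwinFamilyY64
  (log_five_halves_le_d7)

/-! ## The constants `log(5/4)` and `c₂` -/

/-- `log(5/4) = log(5/2) − log 2`. [folklore] -/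
theorem log_five_fourths_eq : Real.log (5 / 4) = Real.log (5 / 2) - Real.log 2 := by
  rw [← Real.log_div (by norm_num) (by norm_num)]; norm_num

/-- `log(5/4) ≤ 0.2231437` (true `0.22314355…`). [folklore] -/
theorem log_five_fourths_le : Real.log (5 / 4) ≤ 0.2231437 := by
  rw [log_five_fourths_eq]; linarith [log_five_halves_le_d7, Real.log_two_gt_d9]

/-- `0 ≤ log(5/4)`. [folklore] -/
theorem log_five_fourths_nonneg : 0 ≤ Real.log (5 / 4) := Real.log_nonneg (by norm_num)

/-- `0.9162907 ≤ log (5/2)` (`log (5/2) = log 2 − log(1 − 1/5)`, ten Taylor terms; companion of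
`log_five_halves_le_d7`). [folklore] -/
theorem le_log_five_halves_d7 : (0.9162907 : ℝ) ≤ Real.log (5 / 2) := by
  have h := Real.abs_log_sub_add_sum_range_le (x := (1 / 5 : ℝ))
    (by rw [abs_of_pos (by norm_num)]; norm_num) 10
  rw [abs_le] at h
  have h2 := h.2
  simp only [Finset.sum_range_succ, Finset.sum_range_zero] at h2
  norm_num [abs_of_pos] at h2
  have e : Real.log (5 / 2) = Real.log 2 - Real.log (4 / 5) := by
    rw [← Real.log_div (by norm_num) (by norm_num)]; norm_num
  have hl2 := Real.log_two_gt_d9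
  rw [e]; linarith

/-- `0.2231435 ≤ log(5/4)`. [folklore] -/
theorem le_log_five_fourths : 0.2231435 ≤ Real.log (5 / 4) := by
  rw [log_five_fourths_eq]; linarith [le_log_five_halves_d7, Real.log_two_lt_d9]

/-- `c₂ = (5 log(5/4) + 3 log 2)/3 = (5 log 5 − 7 log 2)/3`. [folklore] -/
theorem classCeiling_eq : (5 * Real.log (5 / 4) + 3 * Real.log 2) / 3 =
    (5 * Real.log 5 - 7 * Real.log 2) / 3 := by
  have h : Real.log (5 / 4) = Real.log 5 - Real.log 4 := Real.log_div (by norm_num) (by norm_num)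
  have h4 : Real.log (4 : ℝ) = 2 * Real.log 2 := by
    rw [show (4 : ℝ) = 2 ^ 2 by norm_num, Real.log_pow]; push_cast; ring
  rw [h, h4]; ring

/-- `1.06505 ≤ c₂ ≤ 1.06506`. [folklore] -/
theorem classCeiling_bounds : 1.06505 ≤ (5 * Real.log (5 / 4) + 3 * Real.log 2) / 3 ∧
    (5 * Real.log (5 / 4) + 3 * Real.log 2) / 3 ≤ 1.06506 := by
  have hl2 := Real.log_two_gt_d9
  have hl2' := Real.log_two_lt_d9
  have hP := log_five_halves_le_d7
  have hP' := le_log_five_halves_d7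
  rw [log_five_fourths_eq]
  constructor <;> linarith

/-! ## The window of `p` and `p ≤ q_j = 10j` -/

/-- The explicit member `p_j = ⌈25 j log(5/4)/log 2⌉ + 29` lies in the window
`[25 j log(5/4) + 29 log 2, 25 j log(5/4) + 30 log 2]` (after multiplying by `log 2`). [folklore] -/
theorem corner_p_spec (j : ℕ) :
    25 * (j : ℝ) * Real.log (5 / 4) + 29 * Real.log 2 ≤
        ((⌈25 * (j : ℝ) * Real.log (5 / 4) / Real.log 2⌉₊ + 29 : ℕ) : ℝ) * Real.log 2 ∧
      ((⌈25 * (j : ℝ) * Real.log (5 / 4) / Real.log 2⌉₊ + 29 : ℕ) : ℝ) * Real.log 2 ≤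
        25 * (j : ℝ) * Real.log (5 / 4) + 30 * Real.log 2 := by
  have hL : 0 < Real.log 2 := Real.log_pos one_lt_two
  set x : ℝ := 25 * (j : ℝ) * Real.log (5 / 4) / Real.log 2 with hx
  have hx0 : 0 ≤ x := div_nonneg (by positivity [log_five_fourths_nonneg]) hL.le
  have h1 : x ≤ (⌈x⌉₊ : ℝ) := Nat.le_ceil x
  have h2 : ((⌈x⌉₊ : ℕ) : ℝ) < x + 1 := Nat.ceil_lt_add_one hx0
  have ex : x * Real.log 2 = 25 * (j : ℝ) * Real.log (5 / 4) := by rw [hx]; field_simp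
  have h1' := mul_le_mul_of_nonneg_right h1 hL.le
  have h2' := mul_le_mul_of_nonneg_right h2.le hL.le
  push_cast
  constructor <;> nlinarith [h1', h2', ex]

/-- **`p ≤ q_j = 10j` from `j = 16` on** (`25 j log(5/4) + 30 log 2 ≤ 10 j log 2` iff
`j ≥ 30 log 2/(10 log 2 − 25 log(5/4)) = 15.37…`). [folklore] -/
theorem corner_p_le (j p : ℕ) (hj : 16 ≤ j)
    (hphi : (p : ℝ) * Real.log 2 ≤ 25 * (j : ℝ) * Real.log (5 / 4) + 30 * Real.log 2) :
    p ≤ 10 * j := by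
  have hJ : (16 : ℝ) ≤ j := by exact_mod_cast hj
  have hL : 0 < Real.log 2 := Real.log_pos one_lt_two
  have hl2 := Real.log_two_gt_d9
  have hl2' := Real.log_two_lt_d9
  have h54 := log_five_fourths_le
  have h1 : 25 * (j : ℝ) * Real.log (5 / 4) ≤ 25 * (j : ℝ) * 0.2231437 :=
    mul_le_mul_of_nonneg_left h54 (by positivity)
  have h2 : 10 * (j : ℝ) * 0.6931471803 ≤ 10 * (j : ℝ) * Real.log 2 :=
    mul_le_mul_of_nonneg_left hl2.le (by positivity)
  have key : (p : ℝ) * Real.log 2 ≤ 10 * (j : ℝ) * Real.log 2 := by linarith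
  have h : (p : ℝ) ≤ 10 * (j : ℝ) := le_of_mul_le_mul_right key hL
  exact_mod_cast h

/-! ## The band condition along the corner family -/

/-- **The corner family lies on the sharp band for every `j ≥ 16`:**
`c₁(κ_j)·j + 2 ≤ j²·δ(κ_j)`, `κ_j = p/(10j)`.  Indeed `j² δ(κ_j) = j p log 2/10 − (5/2) j² log(5/4) ≥
2.9 j log 2` by the lower window bound, while `c₁ ≤ 2 log(5/2)`. [folklore] -/
theorem corner_band (j p : ℕ) (hj : 16 ≤ j)
    (hplo : 25 * (j : ℝ) * Real.log (5 / 4) + 29 * Real.log 2 ≤ (p : ℝ) * Real.log 2)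
    (hphi : (p : ℝ) * Real.log 2 ≤ 25 * (j : ℝ) * Real.log (5 / 4) + 30 * Real.log 2) :
    ((1 + (p : ℝ) / ((10 * j : ℕ) : ℝ)) * Real.log (5 / 2) +
          (1 - (p : ℝ) / ((10 * j : ℕ) : ℝ)) * Real.log 2) * j + 2 ≤
      (j : ℝ) ^ 2 * ((5 / 2 + (p : ℝ) / ((10 * j : ℕ) : ℝ)) * Real.log 2 - 5 / 2 * Real.log (5 / 2)) := by
  have hJ : (16 : ℝ) ≤ j := by exact_mod_cast hj
  have hjpos : (0 : ℝ) < j := by linarith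
  have hl2 := Real.log_two_gt_d9
  have hP7 := log_five_halves_le_d7
  have hp := corner_p_le j p hj hphi
  have hp' : (p : ℝ) ≤ 10 * j := by exact_mod_cast hp
  have hq : ((10 * j : ℕ) : ℝ) = 10 * (j : ℝ) := by push_cast; ring
  rw [hq]
  have hP54 : Real.log (5 / 2) = Real.log (5 / 4) + Real.log 2 := by
    rw [log_five_fourths_eq]; ring
  have h54 := log_five_fourths_nonneg
  -- left side `≤ 2 log(5/2) · j + 2`
  have hκ1 : (p : ℝ) / (10 * j) ≤ 1 := by rw [div_le_one (by positivity)]; exact hp'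
  have hκ0 : 0 ≤ (p : ℝ) / (10 * j) := by positivity
  have hc1 : (1 + (p : ℝ) / (10 * j)) * Real.log (5 / 2) + (1 - (p : ℝ) / (10 * j)) * Real.log 2 ≤
      2 * Real.log (5 / 2) := by
    rw [hP54]
    nlinarith [mul_nonneg (sub_nonneg.2 hκ1) h54]
  have hL : ((1 + (p : ℝ) / (10 * j)) * Real.log (5 / 2) + (1 - (p : ℝ) / (10 * j)) * Real.log 2) * j
      ≤ 2 * Real.log (5 / 2) * j := mul_le_mul_of_nonneg_right hc1 hjpos.le
  -- right side `= j p log 2/10 − (5/2) j² log(5/4) ≥ 2.9 j log 2`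
  have hR : (j : ℝ) ^ 2 * ((5 / 2 + (p : ℝ) / (10 * j)) * Real.log 2 - 5 / 2 * Real.log (5 / 2)) =
      (j : ℝ) * ((p : ℝ) * Real.log 2) / 10 - 5 / 2 * (j : ℝ) ^ 2 * Real.log (5 / 4) := by
    rw [hP54]; field_simp; ring
  have hprod := mul_le_mul_of_nonneg_left hplo hjpos.le
  have hR' : 29 / 10 * (j : ℝ) * Real.log 2 ≤
      (j : ℝ) ^ 2 * ((5 / 2 + (p : ℝ) / (10 * j)) * Real.log 2 - 5 / 2 * Real.log (5 / 2)) := by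
    rw [hR]; nlinarith [hprod]
  have h3 : 2 * Real.log (5 / 2) * j ≤ 2 * 0.9162908 * j :=
    mul_le_mul_of_nonneg_right (by linarith) hjpos.le
  have h4 : 29 / 10 * (j : ℝ) * 0.6931471803 ≤ 29 / 10 * (j : ℝ) * Real.log 2 :=
    mul_le_mul_of_nonneg_left hl2.le (by positivity)
  nlinarith [hL, hR', h3, h4, hJ]

/-! ## Exactness and defect of the corner family -/

/-- **Every member of the corner family is an exact value of `ω(1,·,·)`** (`j ≥ 16`, `p` in the
window): `ω(1, t_j, r_j) = 1 + r_j` (`≤`) at the counts `(3·q j + 2q, 2 q j 2^{j+1} − n₃,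
3 q j + 2q + 2p, q j − 2q, 0, 2 q j)`, `q = 10j`.
[cite: CoppersmithWinograd1990, §8] [cite: AlmanDuanVassilevskaWilliamsXuXuZhou2025, Thm. 3.2, §3.4] -/
theorem corner_tight (j p : ℕ) (hj : 16 ≤ j)
    (hplo : 25 * (j : ℝ) * Real.log (5 / 4) + 29 * Real.log 2 ≤ (p : ℝ) * Real.log 2)
    (hphi : (p : ℝ) * Real.log 2 ≤ 25 * (j : ℝ) * Real.log (5 / 4) + 30 * Real.log 2) :
    omegaRect ℂ 1
        (((j : ℝ) * ((3 * (10 * j) * j + 2 * (10 * j) : ℕ) : ℝ)) /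
          (((j : ℝ) + 1) * ((3 * (10 * j) * j + 2 * (10 * j) + 2 * p : ℕ) : ℝ) + ((0 : ℕ) : ℝ)))
        ((((j : ℝ) + 1) *
              ((2 * (10 * j) * j * 2 ^ (j + 1) - (3 * (10 * j) * j + 2 * (10 * j) + 2 * p) : ℕ) : ℝ) +
            ((3 * (10 * j) * j + 2 * (10 * j) : ℕ) : ℝ) + ((10 * j * j - 2 * (10 * j) : ℕ) : ℝ)) /
          (((j : ℝ) + 1) * ((3 * (10 * j) * j + 2 * (10 * j) + 2 * p : ℕ) : ℝ) + ((0 : ℕ) : ℝ))) ≤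
      1 + (((j : ℝ) + 1) *
              ((2 * (10 * j) * j * 2 ^ (j + 1) - (3 * (10 * j) * j + 2 * (10 * j) + 2 * p) : ℕ) : ℝ) +
            ((3 * (10 * j) * j + 2 * (10 * j) : ℕ) : ℝ) + ((10 * j * j - 2 * (10 * j) : ℕ) : ℝ)) /
          (((j : ℝ) + 1) * ((3 * (10 * j) * j + 2 * (10 * j) + 2 * p : ℕ) : ℝ) + ((0 : ℕ) : ℝ)) :=
  band_tight p (10 * j) j (by omega) (corner_p_le j p hj hphi) hj (corner_band j p hj hplo hphi)

/-- **The corner family proper (`p = p_j = ⌈25 j log(5/4)/log 2⌉ + 29`) is exact for every `j ≥ 16`.**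
[cite: CoppersmithWinograd1990, §8] [cite: AlmanDuanVassilevskaWilliamsXuXuZhou2025, Thm. 3.2, §3.4] -/
theorem cornerFamily_tight (j : ℕ) (hj : 16 ≤ j) :
    omegaRect ℂ 1
        (((j : ℝ) * ((3 * (10 * j) * j + 2 * (10 * j) : ℕ) : ℝ)) /
          (((j : ℝ) + 1) * ((3 * (10 * j) * j + 2 * (10 * j) +
              2 * (⌈25 * (j : ℝ) * Real.log (5 / 4) / Real.log 2⌉₊ + 29) : ℕ) : ℝ) + ((0 : ℕ) : ℝ)))
        ((((j : ℝ) + 1) *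
              ((2 * (10 * j) * j * 2 ^ (j + 1) - (3 * (10 * j) * j + 2 * (10 * j) +
                2 * (⌈25 * (j : ℝ) * Real.log (5 / 4) / Real.log 2⌉₊ + 29)) : ℕ) : ℝ) +
            ((3 * (10 * j) * j + 2 * (10 * j) : ℕ) : ℝ) + ((10 * j * j - 2 * (10 * j) : ℕ) : ℝ)) /
          (((j : ℝ) + 1) * ((3 * (10 * j) * j + 2 * (10 * j) +
              2 * (⌈25 * (j : ℝ) * Real.log (5 / 4) / Real.log 2⌉₊ + 29) : ℕ) : ℝ) + ((0 : ℕ) : ℝ))) ≤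
      1 + (((j : ℝ) + 1) *
              ((2 * (10 * j) * j * 2 ^ (j + 1) - (3 * (10 * j) * j + 2 * (10 * j) +
                2 * (⌈25 * (j : ℝ) * Real.log (5 / 4) / Real.log 2⌉₊ + 29)) : ℕ) : ℝ) +
            ((3 * (10 * j) * j + 2 * (10 * j) : ℕ) : ℝ) + ((10 * j * j - 2 * (10 * j) : ℕ) : ℝ)) /
          (((j : ℝ) + 1) * ((3 * (10 * j) * j + 2 * (10 * j) +
              2 * (⌈25 * (j : ℝ) * Real.log (5 / 4) / Real.log 2⌉₊ + 29) : ℕ) : ℝ) + ((0 : ℕ) : ℝ)) :=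
  corner_tight j _ hj (corner_p_spec j).1 (corner_p_spec j).2

/-- **Defect of the corner family: `(1 − t_j)·log r_j ≤ c₂ + 2 log 2/j`** (`j ≥ 16`, `p` in the window;
counts bound by the count equations with `q = 10j`). [folklore] -/
theorem corner_defect_le (j p n₁ n₂ n₃ n₄ : ℕ) (hj : 16 ≤ j)
    (hphi : (p : ℝ) * Real.log 2 ≤ 25 * (j : ℝ) * Real.log (5 / 4) + 30 * Real.log 2)
    (h₁ : n₁ = 3 * (10 * j) * j + 2 * (10 * j))
    (h₂ : n₂ + (3 * (10 * j) * j + 2 * (10 * j) + 2 * p) = 2 * (10 * j) * j * 2 ^ (j + 1))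
    (h₃ : n₃ = 3 * (10 * j) * j + 2 * (10 * j) + 2 * p) (h₄ : n₄ + 2 * (10 * j) = 10 * j * j) :
    (1 - ((j : ℝ) * n₁) / (((j : ℝ) + 1) * n₃ + ((0 : ℕ) : ℝ))) *
        Real.log ((((j : ℝ) + 1) * n₂ + n₁ + n₄) / (((j : ℝ) + 1) * n₃ + ((0 : ℕ) : ℝ))) ≤
      (5 * Real.log (5 / 4) + 3 * Real.log 2) / 3 + 2 * Real.log 2 / j := by
  have hjpos : (0 : ℝ) < j := by exact_mod_cast (show 0 < j by omega)
  have h := band_defect_le p (10 * j) j n₁ n₂ n₃ n₄ h₁ h₂ h₃ h₄ (by omega)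
    (corner_p_le j p hj hphi) (by omega)
  refine h.trans ?_
  have hq : ((10 * j : ℕ) : ℝ) = 10 * (j : ℝ) := by push_cast; ring
  rw [hq]
  have e1 : (3 * (10 * (j : ℝ)) + 2 * p) / (3 * (10 * (j : ℝ))) * Real.log 2 =
      (30 * j * Real.log 2 + 2 * ((p : ℝ) * Real.log 2)) / (30 * j) := by
    field_simp; ring
  have e2 : (5 * Real.log (5 / 4) + 3 * Real.log 2) / 3 + 2 * Real.log 2 / j =
      (50 * j * Real.log (5 / 4) + 30 * j * Real.log 2 + 60 * Real.log 2) / (30 * j) := by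
    field_simp; ring
  rw [e1, e2]
  exact div_le_div_of_nonneg_right (by nlinarith [hphi, hjpos]) (by positivity)

/-! ## The family constants `log θ_j = (3 q_j + 2 p_j)/(3 q_j) · log 2` tend to the class ceiling -/

/-- Upper squeeze: `log θ_j ≤ c₂ + 2 log 2/j` (`j ≥ 1`, upper window bound). [folklore] -/
theorem corner_logTheta_le (j p : ℕ) (hj : 1 ≤ j)
    (hphi : (p : ℝ) * Real.log 2 ≤ 25 * (j : ℝ) * Real.log (5 / 4) + 30 * Real.log 2) :
    (3 * (10 * (j : ℝ)) + 2 * (p : ℝ)) / (3 * (10 * (j : ℝ))) * Real.log 2 ≤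
      (5 * Real.log (5 / 4) + 3 * Real.log 2) / 3 + 2 * Real.log 2 / j := by
  have hjpos : (0 : ℝ) < j := by exact_mod_cast (show 0 < j by omega)
  have e1 : (3 * (10 * (j : ℝ)) + 2 * p) / (3 * (10 * (j : ℝ))) * Real.log 2 =
      (30 * j * Real.log 2 + 2 * ((p : ℝ) * Real.log 2)) / (30 * j) := by
    field_simp; ring
  have e2 : (5 * Real.log (5 / 4) + 3 * Real.log 2) / 3 + 2 * Real.log 2 / j =
      (50 * j * Real.log (5 / 4) + 30 * j * Real.log 2 + 60 * Real.log 2) / (30 * j) := by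
    field_simp; ring
  rw [e1, e2]
  exact div_le_div_of_nonneg_right (by nlinarith [hphi, hjpos]) (by positivity)

/-- Lower squeeze: `c₂ + (29/15) log 2/j ≤ log θ_j` (`j ≥ 1`, lower window bound). [folklore] -/
theorem corner_le_logTheta (j p : ℕ) (hj : 1 ≤ j)
    (hplo : 25 * (j : ℝ) * Real.log (5 / 4) + 29 * Real.log 2 ≤ (p : ℝ) * Real.log 2) :
    (5 * Real.log (5 / 4) + 3 * Real.log 2) / 3 + 29 / 15 * Real.log 2 / j ≤
      (3 * (10 * (j : ℝ)) + 2 * (p : ℝ)) / (3 * (10 * (j : ℝ))) * Real.log 2 := by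
  have hjpos : (0 : ℝ) < j := by exact_mod_cast (show 0 < j by omega)
  have e1 : (3 * (10 * (j : ℝ)) + 2 * p) / (3 * (10 * (j : ℝ))) * Real.log 2 =
      (30 * j * Real.log 2 + 2 * ((p : ℝ) * Real.log 2)) / (30 * j) := by
    field_simp; ring
  have e2 : (5 * Real.log (5 / 4) + 3 * Real.log 2) / 3 + 29 / 15 * Real.log 2 / j =
      (50 * j * Real.log (5 / 4) + 30 * j * Real.log 2 + 58 * Real.log 2) / (30 * j) := by
    field_simp; ring
  rw [e1, e2]
  exact div_le_div_of_nonneg_right (by nlinarith [hplo, hjpos]) (by positivity)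

/-- **`log θ_j → c₂`**: the constants of the corner family (`p = p_j`) tend to the twin-class ceiling
`(5 log(5/4) + 3 log 2)/3` — the ceiling of `clause_above_classCeiling` is ATTAINED IN THE LIMIT by a
family of exact values of `ω(1,·,·)`. [folklore] -/
theorem corner_logTheta_tendsto :
    Tendsto (fun j : ℕ => (3 * (10 * (j : ℝ)) +
        2 * (((⌈25 * (j : ℝ) * Real.log (5 / 4) / Real.log 2⌉₊ + 29 : ℕ) : ℝ))) /
          (3 * (10 * (j : ℝ))) * Real.log 2)
      atTop (𝓝 ((5 * Real.log (5 / 4) + 3 * Real.log 2) / 3)) := by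
  have hlo : Tendsto (fun j : ℕ => (5 * Real.log (5 / 4) + 3 * Real.log 2) / 3 +
      29 / 15 * Real.log 2 / (j : ℝ)) atTop (𝓝 ((5 * Real.log (5 / 4) + 3 * Real.log 2) / 3)) := by
    simpa using (tendsto_const_div_atTop_nhds_zero_nat (29 / 15 * Real.log 2)).const_add
      ((5 * Real.log (5 / 4) + 3 * Real.log 2) / 3)
  have hhi : Tendsto (fun j : ℕ => (5 * Real.log (5 / 4) + 3 * Real.log 2) / 3 +
      2 * Real.log 2 / (j : ℝ)) atTop (𝓝 ((5 * Real.log (5 / 4) + 3 * Real.log 2) / 3)) := by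
    simpa using (tendsto_const_div_atTop_nhds_zero_nat (2 * Real.log 2)).const_add
      ((5 * Real.log (5 / 4) + 3 * Real.log 2) / 3)
  refine tendsto_of_tendsto_of_tendsto_of_le_of_le' hlo hhi ?_ ?_
  · exact Filter.eventually_atTop.2 ⟨1, fun j hj => corner_le_logTheta j _ hj (corner_p_spec j).1⟩
  · exact Filter.eventually_atTop.2 ⟨1, fun j hj => corner_logTheta_le j _ hj (corner_p_spec j).2⟩

/-- Onset data: at `j = 16` the window contains `p = 158` (`= p_16`), so `(p, q, j) = (158, 160, 16)`
is a corner member — counts `(8000, 20j²·2¹⁷ − 8316, 8316, 2240, 0, 5120)`, `t_16 = 16·8000/(17·8316)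
= 32000/35343 = 0.9054…`, `r_16 = 8.4…·10⁴`, defect bound `c₂ + log 2/8 = 1.1517`. [folklore] -/
theorem corner_window_16 : 25 * (16 : ℝ) * Real.log (5 / 4) + 29 * Real.log 2 ≤ (158 : ℝ) * Real.log 2 ∧
    (158 : ℝ) * Real.log 2 ≤ 25 * (16 : ℝ) * Real.log (5 / 4) + 30 * Real.log 2 := by
  have hl2 := Real.log_two_gt_d9
  have hl2' := Real.log_two_lt_d9
  have h54 := log_five_fourths_le
  have h54' := le_log_five_fourths
  constructor <;> linarith

end Summit.MatrixMultiplication.MatrixMultiplication.Theorems.SaturationLadderCornerFamily
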